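import Summits.QuantumAdvantage.QuantumAdvantage.Theses.LinnikCubicClassGroups
import Literature.Algebra.EuclideanLattices.LLLEnumerationBox

/-!
# Crux `LinnikCubicClassGroups.PureCubicClassGroupFBQP` (stmt-QuantumAdvantage-11544) — stub `stub_lllEnumeration`

Line `arakelov-giant-step-cycle`, stub `stub_lllEnumeration` (S3b-C): the two generic lattice facts
used to run the tree's exact integer LLL on a ROUNDED scaled copy `B'` of the true embedded basis `B`
of a rank-`3` ideal lattice and still enumerate the true short vectors by their integer coordinates.

1. ENUMERATION BOX (`abs_coeff_le_rank_three`): if `b₀, b₁, b₂` are linearly independent and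
   LLL-reduced (`δ = 3/4`) in a real inner product space and no nonzero vector of the lattice they
   span is shorter than `m > 0`, then every lattice vector `∑ cᵢ bᵢ` of norm `≤ ρ` has
   `|cᵢ| ≤ 4ρ/m + 2`. From the tree's `LLLEnumerationBox`: the enumeration recursion
   `|cⱼ| ≤ ‖v‖/‖b*ⱼ‖ + ½ ∑_{i>j} |cᵢ|` (size reduction) and `m² ≤ 2ʲ ‖b*ⱼ‖²` (LLL82 (1.7)), whence
   `‖b*₀‖ ≥ m`, `‖b*₁‖, ‖b*₂‖ ≥ m/2` and `|c₂| ≤ 2ρ/m`, `|c₁| ≤ 3ρ/m`, `|c₀| ≤ 7ρ/(2m)`.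
2. PERTURBATION: for `3 × 3` real matrices `B, B'` within `δ` entrywise and `μ ‖v‖ ≤ ‖v B‖`
   (sup norms, `μ > 0`), `‖c B‖ (1 - 3δ/μ) ≤ ‖c B'‖ ≤ ‖c B‖ (1 + 3δ/μ)` — the case `|m| = 3` of
   `norm_vecMul_perturb_le` / `norm_vecMul_perturb_ge`.
-/

-- the problem namespace repeats the summit name (`QuantumAdvantage.QuantumAdvantage`)
set_option linter.dupNamespace false

namespace Summit.QuantumAdvantage.QuantumAdvantage.Theorems.LinnikCubicClassGroups

open Literature.Algebra.EuclideanLattices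
open InnerProductSpace Finset
open scoped InnerProductSpace

/-- **Rank-3 enumeration box.** For a linearly independent, LLL-reduced (`δ = 3/4`) family
`b₀, b₁, b₂` in a real inner product space whose lattice has no nonzero vector shorter than `m > 0`,
every `v = ∑ cᵢ bᵢ` (`c ∈ ℤ³`) with `‖v‖ ≤ ρ` has `|cᵢ| ≤ 4ρ/m + 2` (indeed `≤ 7ρ/(2m)`). -/
theorem abs_coeff_le_rank_three {E : Type*} [NormedAddCommGroup E] [InnerProductSpace ℝ E]
    {b : Fin 3 → E} (hli : LinearIndependent ℝ b) (h : IsLLLReduced (3 / 4) b) {m ρ : ℝ}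
    (hm : 0 < m) (hmin : ∀ c : Fin 3 → ℤ, c ≠ 0 → m ≤ ‖∑ i, (c i : ℝ) • b i‖) (c : Fin 3 → ℤ)
    (hρ : ‖∑ i, (c i : ℝ) • b i‖ ≤ ρ) (i : Fin 3) : |(c i : ℝ)| ≤ 4 * ρ / m + 2 := by
  have hρ0 : 0 ≤ ρ := (norm_nonneg _).trans hρ
  have hne : ∀ j, gramSchmidt ℝ b j ≠ 0 := fun j => gramSchmidt_ne_zero j hli
  have hpos : ∀ j, 0 < ‖gramSchmidt ℝ b j‖ := fun j => norm_pos_iff.2 (hne j)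
  -- `m ≤ 2 ‖b*ⱼ‖` for all `j`, and `m ≤ ‖b*₀‖`
  have hsq := fun j => sq_le_two_pow_mul_sq_norm_gramSchmidt h hm.le hmin j
  have h2 : ∀ j : Fin 3, m ≤ 2 * ‖gramSchmidt ℝ b j‖ := by
    intro j
    have hj : (2 : ℝ) ^ (j : ℕ) ≤ 2 ^ 2 := pow_le_pow_right₀ (by norm_num) (by omega)
    have : m ^ 2 ≤ (2 * ‖gramSchmidt ℝ b j‖) ^ 2 :=
      calc m ^ 2 ≤ 2 ^ (j : ℕ) * ‖gramSchmidt ℝ b j‖ ^ 2 := hsq j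
        _ ≤ 2 ^ 2 * ‖gramSchmidt ℝ b j‖ ^ 2 := mul_le_mul_of_nonneg_right hj (sq_nonneg _)
        _ = (2 * ‖gramSchmidt ℝ b j‖) ^ 2 := by ring
    exact (pow_le_pow_iff_left₀ hm.le (by positivity) two_ne_zero).1 this
  have h0 : m ≤ ‖gramSchmidt ℝ b 0‖ := by
    have : m ^ 2 ≤ ‖gramSchmidt ℝ b 0‖ ^ 2 := by simpa using hsq 0
    exact (pow_le_pow_iff_left₀ hm.le (norm_nonneg _) two_ne_zero).1 this
  -- the recursion, with real coefficients `c' i = c i`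
  set c' : Fin 3 → ℝ := fun i => (c i : ℝ) with hc'
  have hrec := fun j => abs_coeff_le_of_isSizeReduced h.isSizeReduced c' (hne j)
  have hv : ∀ j : Fin 3, ‖∑ i, c' i • b i‖ / ‖gramSchmidt ℝ b j‖ ≤ 2 * ρ / m := by
    intro j
    rw [div_le_div_iff₀ (hpos j) hm]
    calc ‖∑ i, c' i • b i‖ * m ≤ ρ * m := mul_le_mul_of_nonneg_right hρ hm.le
      _ ≤ ρ * (2 * ‖gramSchmidt ℝ b j‖) := mul_le_mul_of_nonneg_left (h2 j) hρ0
      _ = 2 * ρ * ‖gramSchmidt ℝ b j‖ := by ring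
  have hv0 : ‖∑ i, c' i • b i‖ / ‖gramSchmidt ℝ b 0‖ ≤ ρ / m := by
    rw [div_le_div_iff₀ (hpos 0) hm]
    calc ‖∑ i, c' i • b i‖ * m ≤ ρ * m := mul_le_mul_of_nonneg_right hρ hm.le
      _ ≤ ρ * ‖gramSchmidt ℝ b 0‖ := mul_le_mul_of_nonneg_left h0 hρ0
  have hI2 : Ioi (2 : Fin 3) = ∅ := by decide
  have hI1 : Ioi (1 : Fin 3) = {2} := by decide
  have hI0 : Ioi (0 : Fin 3) = {1, 2} := by decide
  -- `|c₂| ≤ 2ρ/m`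
  have hc2 : |c' 2| ≤ 2 * ρ / m := by
    have := hrec 2
    rw [hI2, sum_empty, mul_zero, add_zero] at this
    exact this.trans (hv 2)
  -- `|c₁| ≤ 2ρ/m + |c₂|/2 ≤ 3ρ/m`
  have hc1 : |c' 1| ≤ 3 * ρ / m := by
    have := hrec 1
    rw [hI1, sum_singleton] at this
    have h3 : 2 * ρ / m + 1 / 2 * (2 * ρ / m) = 3 * ρ / m := by ring
    linarith [hv 1]
  -- `|c₀| ≤ ρ/m + (|c₁| + |c₂|)/2 ≤ 7ρ/(2m)`
  have hc0 : |c' 0| ≤ 7 / 2 * ρ / m := by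
    have := hrec 0
    rw [hI0, sum_pair (by decide : (1 : Fin 3) ≠ 2)] at this
    have h3 : ρ / m + 1 / 2 * (3 * ρ / m + 2 * ρ / m) = 7 / 2 * ρ / m := by ring
    linarith [hv0]
  have hρm : 0 ≤ ρ / m := div_nonneg hρ0 hm.le
  have e2 : 2 * ρ / m = 2 * (ρ / m) := by ring
  have e3 : 3 * ρ / m = 3 * (ρ / m) := by ring
  have e7 : 7 / 2 * ρ / m = 7 / 2 * (ρ / m) := by ring
  have e4 : 4 * ρ / m + 2 = 4 * (ρ / m) + 2 := by ring
  rw [e4]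
  fin_cases i
  · change |c' 0| ≤ _
    linarith
  · change |c' 1| ≤ _
    linarith
  · change |c' 2| ≤ _
    linarith

/-- **S3b-C `stub_lllEnumeration`.** (1) ENUMERATION BOX: if `b₀, b₁, b₂` are linearly independent
and LLL-reduced (`δ = 3/4`) and the lattice they span has no nonzero vector shorter than `m > 0`, then
every lattice vector of norm `≤ ρ` has integer coordinates `|cᵢ| ≤ 4ρ/m + 2`
(`abs_coeff_le_rank_three`). (2) PERTURBATION: for `3 × 3` real matrices `B, B'` within `δ`
entrywise and `‖v B‖ ≥ μ ‖v‖` (sup norms), integer rows satisfy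
`‖c B'‖ ∈ [‖c B‖ (1 − 3δ/μ), ‖c B‖ (1 + 3δ/μ)]` (`norm_vecMul_perturb_le/ge` with `|Fin 3| = 3`;
the hypothesis `3δ < μ` is not needed). -/
theorem stub_lllEnumeration :
    (∀ (b : Fin 3 → EuclideanSpace ℝ (Fin 3)), LinearIndependent ℝ b → IsLLLReduced (3 / 4) b →
      ∀ (m ρ : ℝ), 0 < m →
        (∀ c : Fin 3 → ℤ, c ≠ 0 → m ≤ ‖∑ i, (c i : ℝ) • b i‖) →
        ∀ c : Fin 3 → ℤ, ‖∑ i, (c i : ℝ) • b i‖ ≤ ρ → ∀ i, |(c i : ℝ)| ≤ 4 * ρ / m + 2) ∧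
    (∀ (B B' : Matrix (Fin 3) (Fin 3) ℝ) (δ μ : ℝ), 0 ≤ δ → 0 < μ →
      (∀ i j, |B i j - B' i j| ≤ δ) →
      (∀ v : Fin 3 → ℝ, μ * ‖v‖ ≤ ‖Matrix.vecMul v B‖) →
      3 * δ < μ →
      ∀ c : Fin 3 → ℤ,
        ‖Matrix.vecMul (fun i => (c i : ℝ)) B'‖ ≤ ‖Matrix.vecMul (fun i => (c i : ℝ)) B‖ * (1 + 3 * δ / μ) ∧
        ‖Matrix.vecMul (fun i => (c i : ℝ)) B‖ * (1 - 3 * δ / μ) ≤ ‖Matrix.vecMul (fun i => (c i : ℝ)) B'‖) := by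
  refine ⟨fun b hli h m ρ hm hmin c hρ i => abs_coeff_le_rank_three hli h hm hmin c hρ i,
    fun B B' δ μ hδ hμ hBB' hB _ c => ?_⟩
  have h1 := norm_vecMul_perturb_le B B' hδ hμ hBB' hB (fun i => (c i : ℝ))
  have h2 := norm_vecMul_perturb_ge B B' hδ hμ hBB' hB (fun i => (c i : ℝ))
  rw [Fintype.card_fin] at h1 h2
  push_cast at h1 h2
  exact ⟨h1, h2⟩

end Summit.QuantumAdvantage.QuantumAdvantage.Theorems.LinnikCubicClassGroups
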